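import Literature.NumberTheory.EllipticCurves.GoodReductionLangLift
import Literature.NumberTheory.EllipticCurves.UnramifiedFormalGroupH1Proofs
import Literature.NumberTheory.EllipticCurves.UnramifiedLayerRootsProofs
import Literature.NumberTheory.EllipticCurves.LocalFrobeniusGenerationProofs
import HarnessLib

/-!
# Inputs for the vanishing of unramified classes at good reduction: graded Hilbert 90 on the
# unramified layers, equivariant Hensel lifts, and points of `E₁` with prescribed parameter

`Proofs` file (theorems only, no definitions, no named facts) in topic
`NumberTheory/EllipticCurves`; a step of the discharge of
`Literature.NumberTheory.EllipticCurves.Milne2006_unramifiedClass_eq_zero` (`PeriodIndexSupport`;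
Milne, *Arithmetic Duality Theorems*, Prop. I.3.8) and of `finite_support` (`PeriodIndex`).
Setting of `SelmerInertia` / `UnramifiedLayerRootsProofs`: `K_v`, `K̄_v` with the spectral
valuation `w` (`hw`), `Γ_{K_v}` acting through `toAlgEquiv`, the prime `𝔐` of `\bar 𝓞_v`, a
local arithmetic Frobenius `F` (`IsArithFrobAt`), `q = #k_v`. It supplies the hypotheses `hres`
and `hlift` of the abstract successive approximation
`FormalGroupChart.exists_map_sub_eq_of_sum_eq_zero` (`UnramifiedFormalGroupH1Proofs`) for the
layers `K_v(ζ)`, `ζ` a primitive `(qⁿ-1)`-th root of unity: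

* `spectralValuation_frobenius_pow_sub_pow_lt_one`: `|Fʲ z - z^{qʲ}|_v < 1` on `w`-integers;
  `apply_rootOfUnity_of_forall_sub_pow_lt_one`: such an `F` acts on roots of unity of order
  prime to `p` by `ζ ↦ ζ^q` (Serre, *Local Fields*, IV §4 Prop. 16).
* `exists_frob_sub_sub_lt_one` (**graded additive Hilbert 90**, `hres`): for a `w`-integer `u`
  with `|Σ_{j<n} Fʲ u|_v < 1` there is a `w`-integer `t ∈ K_v(ζ)` (a root of unity or `0`) with
  `|F t - t - u|_v < 1`: take an Artin–Schreier root `t₀` of `X^q - X = u` in `K̄_v`, observe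
  `Fᵏ t₀ ≡ t₀ + Σ_{j<k} Fʲ u`, so `Fⁿ t₀ ≡ t₀`, and let `t` be the Teichmüller representative of
  `t₀` (`exists_rootOfUnity_spectralValuation_sub_lt_one`): `Fⁿ t = t` forces `t^{qⁿ-1} = 1`
  (Serre, *Local Fields*, X §1 Prop. 1 with V §2).
* `exists_isRoot_sub_mem_forall`: Hensel's lemma over `𝒪_w` (henselian,
  `henselianLocalRing_integer`) together with the invariance of the lift under every isometric
  automorphism fixing the coefficients and the approximate root (uniqueness).
* `FormalGroupChart.val_zCoord_add_neg_le`, `val_zCoord_sub_sub_le`: `z(-P) ≡ -z(P)`,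
  `z(P - Q) ≡ z(P) - z(Q)` modulo squares on `E₁` (complements to `FormalGroupChart`).
* `exists_mem_kernel_zCoord_eq` (**`z : E₁(K̄_v) → 𝔐` is onto, equivariantly**; the source of
  `hlift`): for `|a|_v < 1` a point `P ∈ E₁` with `z(P) = a` fixed by every isometric
  `K_v`-automorphism fixing `a` (Silverman, *AEC*, VII.2.2; the monic cubic of
  `FormalGroupChart.monic_cubic_eval` and Hensel).
* `isOpen_setOf_map_eq` (stabilisers of points are open: `E(K̄_v)` is a discrete
  `Γ_{K_v}`-module, Serre, *Galois Cohomology*, II §1), `mem_of_forall_mem_fixingSubgroup`.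

## References

* J.-P. Serre, *Local Fields*, IV §4 Prop. 16, V §2, X §1 Prop. 1.
* J. Neukirch, *Algebraic Number Theory*, II §4 (4.6), I §9.
* J. H. Silverman, *The Arithmetic of Elliptic Curves*, IV.1, VII.2.2, VIII §1.
* J. S. Milne, *Arithmetic Duality Theorems*, I.3.8.

## Design

`noncomputable section`, `open scoped Classical NNReal`; local notations `(v.adicCompletion K) = K_v`,
`(AlgebraicClosure (v.adicCompletion K)) = K̄_v`, `(v.adicCompletionIntegers K) = 𝓞_v`, `(Nat.card (IsLocalRing.ResidueField (v.adicCompletionIntegers K))) = Nat.card (ResidueField 𝓞_v)`, `(absoluteGaloisGroup.toAlgEquiv (v.adicCompletion K)) = toAlgEquiv`. No definitions.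
Axioms: `propext`, `Classical.choice`, `Quot.sound`.
-/

noncomputable section

open scoped Classical NNReal
open NumberField IsDedekindDomain Field Polynomial ValuativeRel

universe u

namespace IsDedekindDomain.HeightOneSpectrum

open Literature.NumberTheory.EllipticCurves Literature.NumberTheory.EllipticCurves.FormalGroupChart
  Literature.NumberTheory.GaloisRepresentations
  Literature.NumberTheory.GaloisRepresentations.IsNonarchimedeanLocalField WeierstrassCurve

variable {K : Type u} [Field K] [NumberField K] {v : HeightOneSpectrum (𝓞 K)}
  {w : Valuation (AlgebraicClosure (v.adicCompletion K)) ℝ≥0}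
  (hw : ∀ x, (w x : ℝ) = spectralNorm (v.adicCompletion K) (AlgebraicClosure (v.adicCompletion K)) x)


/-! ## Frobenius elements in the language of the spectral valuation -/

/-- `Γ_{K_v}` acts on `K̄_v` through `toAlgEquiv`, multiplicatively: `(στ) x = σ (τ x)`. [folklore] -/
theorem gal_mul_apply (σ τ : absoluteGaloisGroup (v.adicCompletion K)) (x : (AlgebraicClosure (v.adicCompletion K))) : (absoluteGaloisGroup.toAlgEquiv (v.adicCompletion K)) (σ * τ) x = (absoluteGaloisGroup.toAlgEquiv (v.adicCompletion K)) σ ((absoluteGaloisGroup.toAlgEquiv (v.adicCompletion K)) τ x) := by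
  rw [map_mul, AlgEquiv.mul_apply]

/-- Powers: `(σ ^ (k+1)) x = (σ ^ k) (σ x)`. [folklore] -/
theorem gal_pow_succ_apply (σ : absoluteGaloisGroup (v.adicCompletion K)) (k : ℕ) (x : (AlgebraicClosure (v.adicCompletion K))) :
    (absoluteGaloisGroup.toAlgEquiv (v.adicCompletion K)) (σ ^ (k + 1)) x = (absoluteGaloisGroup.toAlgEquiv (v.adicCompletion K)) (σ ^ k) ((absoluteGaloisGroup.toAlgEquiv (v.adicCompletion K)) σ x) := by
  rw [pow_succ, gal_mul_apply]

/-- Powers of `(absoluteGaloisGroup.toAlgEquiv (v.adicCompletion K)) σ` as algebra homomorphisms are `(absoluteGaloisGroup.toAlgEquiv (v.adicCompletion K)) (σ ^ j)`. [folklore] -/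
theorem coe_gal_pow (σ : absoluteGaloisGroup (v.adicCompletion K)) (j : ℕ) :
    (((absoluteGaloisGroup.toAlgEquiv (v.adicCompletion K)) σ : (AlgebraicClosure (v.adicCompletion K)) ≃ₐ[(v.adicCompletion K)] (AlgebraicClosure (v.adicCompletion K))) : (AlgebraicClosure (v.adicCompletion K)) →ₐ[(v.adicCompletion K)] (AlgebraicClosure (v.adicCompletion K))) ^ j = (((absoluteGaloisGroup.toAlgEquiv (v.adicCompletion K)) (σ ^ j) : (AlgebraicClosure (v.adicCompletion K)) ≃ₐ[(v.adicCompletion K)] (AlgebraicClosure (v.adicCompletion K))) : (AlgebraicClosure (v.adicCompletion K)) →ₐ[(v.adicCompletion K)] (AlgebraicClosure (v.adicCompletion K))) := by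
  induction j with
  | zero => ext x; simp
  | succ j ih =>
    rw [pow_succ, ih, pow_succ, map_mul]
    rfl

include hw

omit hw in
/-- `q_v = #k_v ≥ 2`. [folklore] -/
theorem two_le_natCard_residueField : 2 ≤ (Nat.card (IsLocalRing.ResidueField (v.adicCompletionIntegers K))) := by
  haveI : Finite (IsLocalRing.ResidueField (v.adicCompletionIntegers K)) := finite_residueField_adicCompletionIntegers K v
  have : 1 < (Nat.card (IsLocalRing.ResidueField (v.adicCompletionIntegers K))) := Finite.one_lt_card
  omega

/-- **A local arithmetic Frobenius raises residues to the `q_v`-th power**, in the language of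
the spectral valuation: `|Fʲ z - z ^ (q_vʲ)|_v < 1` for `|z|_v ≤ 1` (Mathlib `IsArithFrobAt` at the
prime `𝔐` of `\bar 𝓞_v`; tree `pow_smul_sub_pow_mem_of_isArithFrobAt_local`,
`mem_iff_spectralValuation_lt_one`). Neukirch, *ANT*, I (9.4)–(9.6). [folklore] -/
theorem spectralValuation_frobenius_pow_sub_pow_lt_one {𝔐 : Ideal v.localAbsIntegers}
    (h𝔐 : 𝔐 ∈ v.localPrimesAbove) {F : absoluteGaloisGroup (v.adicCompletion K)} (hF : IsArithFrobAt (v.adicCompletionIntegers K) F 𝔐) (j : ℕ)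
    {z : (AlgebraicClosure (v.adicCompletion K))} (hz : w z ≤ 1) : w ((absoluteGaloisGroup.toAlgEquiv (v.adicCompletion K)) (F ^ j) z - z ^ ((Nat.card (IsLocalRing.ResidueField (v.adicCompletionIntegers K))) ^ j)) < 1 := by
  have hzmem : z ∈ v.localAbsIntegers := (mem_localAbsIntegers_iff_spectralValuation hw).mpr hz
  have h := pow_smul_sub_pow_mem_of_isArithFrobAt_local v h𝔐 hF j ⟨z, hzmem⟩
  rw [mem_iff_spectralValuation_lt_one hw h𝔐] at h
  exact h

/-- The case `j = 1`: `|F z - z ^ q_v|_v < 1` for `|z|_v ≤ 1`. [folklore] -/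
theorem spectralValuation_frobenius_sub_pow_lt_one {𝔐 : Ideal v.localAbsIntegers}
    (h𝔐 : 𝔐 ∈ v.localPrimesAbove) {F : absoluteGaloisGroup (v.adicCompletion K)} (hF : IsArithFrobAt (v.adicCompletionIntegers K) F 𝔐)
    {z : (AlgebraicClosure (v.adicCompletion K))} (hz : w z ≤ 1) : w ((absoluteGaloisGroup.toAlgEquiv (v.adicCompletion K)) F z - z ^ (Nat.card (IsLocalRing.ResidueField (v.adicCompletionIntegers K)))) < 1 := by
  simpa using spectralValuation_frobenius_pow_sub_pow_lt_one hw h𝔐 hF 1 hz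

/-- **A Frobenius acts on roots of unity of order prime to `p` as `ζ ↦ ζ ^ q_v`** — for any
`φ ∈ Γ_{K_v}` with `|φ z - z^{q_v}|_v < 1` on `w`-integers: both `φ ζ` and `ζ ^ q_v` are `N`-th
roots of unity, congruent modulo `𝔐`, and `μ_N` injects into the residue field for `p ∤ N`
(`eq_one_of_pow_eq_one_of_algNorm_sub_one_lt_one`).
Serre, *Local Fields*, IV §4 Prop. 16; Neukirch, *ANT*, II (7.13). [cite: SerreLocalFields1979, Ch. IV §4 Prop. 16] -/
theorem apply_rootOfUnity_of_forall_sub_pow_lt_one {φ : absoluteGaloisGroup (v.adicCompletion K)}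
    (hφq : ∀ z : (AlgebraicClosure (v.adicCompletion K)), w z ≤ 1 → w ((absoluteGaloisGroup.toAlgEquiv (v.adicCompletion K)) φ z - z ^ (Nat.card (IsLocalRing.ResidueField (v.adicCompletionIntegers K)))) < 1)
    {N : ℕ} (hN : IsUnit ((N : ℕ) : 𝒪[(v.adicCompletion K)])) {ζ : (AlgebraicClosure (v.adicCompletion K))} (hζ : ζ ^ N = 1) :
    (absoluteGaloisGroup.toAlgEquiv (v.adicCompletion K)) φ ζ = ζ ^ (Nat.card (IsLocalRing.ResidueField (v.adicCompletionIntegers K))) := by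
  have hN0 : N ≠ 0 := by
    rintro rfl
    rw [Nat.cast_zero] at hN
    exact not_isUnit_zero hN
  have hζ1 : w ζ = 1 := by
    have h := congrArg w hζ
    rw [map_pow, map_one] at h
    exact (pow_eq_one_iff_of_nonneg zero_le hN0).mp h
  have hζ0 : ζ ≠ 0 := (Valuation.ne_zero_iff w).mp (by rw [hζ1]; exact one_ne_zero)
  have hq0 : ζ ^ (Nat.card (IsLocalRing.ResidueField (v.adicCompletionIntegers K))) ≠ 0 := pow_ne_zero _ hζ0
  have hcong := hφq ζ hζ1.le
  have hη : (absoluteGaloisGroup.toAlgEquiv (v.adicCompletion K)) φ ζ / ζ ^ (Nat.card (IsLocalRing.ResidueField (v.adicCompletionIntegers K))) = 1 := by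
    apply eq_one_of_pow_eq_one_of_algNorm_sub_one_lt_one hN
    · rw [div_pow, ← map_pow, hζ, map_one, ← pow_mul, mul_comm, pow_mul, hζ, one_pow, div_one]
    · rw [← spectralValuation_lt_one_iff_algNorm_lt_one hw,
        show (absoluteGaloisGroup.toAlgEquiv (v.adicCompletion K)) φ ζ / ζ ^ (Nat.card (IsLocalRing.ResidueField (v.adicCompletionIntegers K))) - 1 = ((absoluteGaloisGroup.toAlgEquiv (v.adicCompletion K)) φ ζ - ζ ^ (Nat.card (IsLocalRing.ResidueField (v.adicCompletionIntegers K)))) / ζ ^ (Nat.card (IsLocalRing.ResidueField (v.adicCompletionIntegers K))) by field_simp,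
        map_div₀, map_pow, hζ1, one_pow, div_one]
      exact hcong
  rwa [div_eq_one_iff_eq hq0] at hη

/-- Iterate: `φᵏ ζ = ζ ^ (q_vᵏ)` for a root of unity `ζ` of order prime to `p`. [folklore] -/
theorem pow_apply_rootOfUnity_of_forall_sub_pow_lt_one {φ : absoluteGaloisGroup (v.adicCompletion K)}
    (hφq : ∀ z : (AlgebraicClosure (v.adicCompletion K)), w z ≤ 1 → w ((absoluteGaloisGroup.toAlgEquiv (v.adicCompletion K)) φ z - z ^ (Nat.card (IsLocalRing.ResidueField (v.adicCompletionIntegers K)))) < 1)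
    {N : ℕ} (hN : IsUnit ((N : ℕ) : 𝒪[(v.adicCompletion K)])) {ζ : (AlgebraicClosure (v.adicCompletion K))} (hζ : ζ ^ N = 1) (k : ℕ) :
    (absoluteGaloisGroup.toAlgEquiv (v.adicCompletion K)) (φ ^ k) ζ = ζ ^ ((Nat.card (IsLocalRing.ResidueField (v.adicCompletionIntegers K))) ^ k) := by
  induction k with
  | zero => simp
  | succ k ih =>
    rw [pow_succ', gal_mul_apply, ih, map_pow, apply_rootOfUnity_of_forall_sub_pow_lt_one hw hφq hN hζ,
      ← pow_mul, ← pow_succ']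

/-! ## The graded additive Hilbert 90 on the layer `K_v(ζ)`, `ζ` primitive of order `qⁿ - 1` -/

/-- **Graded additive Hilbert 90 for `K_v(ζ)/K_v`, `ζ` a primitive `(qⁿ-1)`-th root of unity.** Let `φ` act as
an arithmetic Frobenius modulo `𝔐` (`|φ z - z^q|_v < 1`), `n ≠ 0`, and `u` a `w`-integer whose "trace"
`u + φu + ⋯ + φⁿ⁻¹u` has `|·|_v < 1`. Then `u ≡ φ t - t (mod 𝔐)` for some `w`-integer `t ∈ K_v(ζ)`
(indeed `t ∈ μ_{qⁿ-1} ∪ {0} ⊆ K_v(ζ)`): with `t₀ ∈ K̄_v` a root of the Artin–Schreier equation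
`X^q - X = u` one has `φᵏ t₀ ≡ t₀ + Σ_{j<k} φʲ u`, so `φⁿ t₀ ≡ t₀`, and the Teichmüller
representative `t` of `t₀` satisfies `φⁿ t = t`, i.e. `t ∈ μ_{qⁿ-1}`; finally
`φ t ≡ t^q ≡ t₀^q = t₀ + u ≡ t + u`. (This is the surjectivity of `F - 1` onto the trace-zero
part of `𝔽_{qⁿ}`, additive Hilbert 90 for `𝔽_{qⁿ}/𝔽_q`, read in `K̄_v` modulo `𝔐`.)
Serre, *Local Fields*, X §1 (Prop. 1, additive Hilbert 90) with V §2 (lifting through the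
filtration). [cite: SerreLocalFields1979, Ch. X §1 Prop. 1] -/
theorem exists_frob_sub_sub_lt_one {φ : absoluteGaloisGroup (v.adicCompletion K)}
    (hφq : ∀ z : (AlgebraicClosure (v.adicCompletion K)), w z ≤ 1 → w ((absoluteGaloisGroup.toAlgEquiv (v.adicCompletion K)) φ z - z ^ (Nat.card (IsLocalRing.ResidueField (v.adicCompletionIntegers K)))) < 1) {n : ℕ} (hn : n ≠ 0)
    {ζ : (AlgebraicClosure (v.adicCompletion K))} (hζ : IsPrimitiveRoot ζ ((Nat.card (IsLocalRing.ResidueField (v.adicCompletionIntegers K))) ^ n - 1)) {u : (AlgebraicClosure (v.adicCompletion K))} (hu1 : w u ≤ 1)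
    (htr : w (∑ j ∈ Finset.range n, (absoluteGaloisGroup.toAlgEquiv (v.adicCompletion K)) (φ ^ j) u) < 1) :
    ∃ t ∈ IntermediateField.adjoin (v.adicCompletion K) {ζ}, w t ≤ 1 ∧ w ((absoluteGaloisGroup.toAlgEquiv (v.adicCompletion K)) φ t - t - u) < 1 := by
  haveI : NeZero ((Nat.card (IsLocalRing.ResidueField (v.adicCompletionIntegers K))) ^ n - 1) := ⟨by
    have h2 := two_le_natCard_residueField (K := K) (v := v)
    have : 1 < (Nat.card (IsLocalRing.ResidueField (v.adicCompletionIntegers K))) ^ n := Nat.one_lt_pow hn (by omega)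
    omega⟩
  have hφw : ∀ (σ : absoluteGaloisGroup (v.adicCompletion K)) (z : (AlgebraicClosure (v.adicCompletion K))), w ((absoluteGaloisGroup.toAlgEquiv (v.adicCompletion K)) σ z) = w z :=
    fun σ z ↦ spectralValuation_smul hw σ z
  have hq2 := two_le_natCard_residueField (K := K) (v := v)
  -- an Artin–Schreier root `t₀` of `X^q - X - u`
  obtain ⟨t₀, ht₀⟩ : ∃ t₀ : (AlgebraicClosure (v.adicCompletion K)), t₀ ^ (Nat.card (IsLocalRing.ResidueField (v.adicCompletionIntegers K))) - t₀ - u = 0 := by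
    have hdeg : (X ^ (Nat.card (IsLocalRing.ResidueField (v.adicCompletionIntegers K))) - X - C u : (AlgebraicClosure (v.adicCompletion K))[X]).degree ≠ 0 := by
      rw [sub_sub, degree_sub_eq_left_of_degree_lt] <;> rw [degree_X_pow]
      · exact_mod_cast (show (Nat.card (IsLocalRing.ResidueField (v.adicCompletionIntegers K))) ≠ 0 by omega)
      · refine (degree_add_le _ _).trans_lt (max_lt ?_ ?_)
        · rw [degree_X]; exact_mod_cast (show 1 < (Nat.card (IsLocalRing.ResidueField (v.adicCompletionIntegers K))) by omega)
        · exact degree_C_le.trans_lt (by exact_mod_cast (show 0 < (Nat.card (IsLocalRing.ResidueField (v.adicCompletionIntegers K))) by omega))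
    obtain ⟨t₀, ht₀⟩ := IsAlgClosed.exists_root _ hdeg
    exact ⟨t₀, by simpa [IsRoot.def, eval_sub, eval_pow, eval_X, eval_C] using ht₀⟩
  have ht₀q : t₀ ^ (Nat.card (IsLocalRing.ResidueField (v.adicCompletionIntegers K))) = t₀ + u := by linear_combination ht₀
  -- `t₀` is a `w`-integer
  have ht₀1 : w t₀ ≤ 1 := by
    by_contra h
    rw [not_le] at h
    have h1 : w (t₀ + u) ≤ w t₀ := by
      refine (Valuation.map_add w _ _).trans (max_le le_rfl (hu1.trans h.le))
    have h2 : w t₀ < w (t₀ ^ (Nat.card (IsLocalRing.ResidueField (v.adicCompletionIntegers K)))) := by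
      rw [map_pow]
      conv_lhs => rw [← pow_one (w t₀)]
      exact pow_lt_pow_right₀ h (by omega)
    rw [ht₀q] at h2
    exact absurd (h2.trans_le h1) (lt_irrefl _)
  -- `φ t₀ ≡ t₀ + u`
  have hd : w ((absoluteGaloisGroup.toAlgEquiv (v.adicCompletion K)) φ t₀ - t₀ - u) < 1 := by
    have := hφq t₀ ht₀1
    rwa [ht₀q, ← sub_sub] at this
  -- `φᵏ t₀ ≡ t₀ + Σ_{j<k} φʲ u`
  have hck : ∀ k : ℕ, w ((absoluteGaloisGroup.toAlgEquiv (v.adicCompletion K)) (φ ^ k) t₀ - t₀ - ∑ j ∈ Finset.range k, (absoluteGaloisGroup.toAlgEquiv (v.adicCompletion K)) (φ ^ j) u) < 1 := by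
    intro k
    induction k with
    | zero => simp
    | succ k ih =>
      have e : (absoluteGaloisGroup.toAlgEquiv (v.adicCompletion K)) (φ ^ (k + 1)) t₀ - t₀ - ∑ j ∈ Finset.range (k + 1), (absoluteGaloisGroup.toAlgEquiv (v.adicCompletion K)) (φ ^ j) u =
          (absoluteGaloisGroup.toAlgEquiv (v.adicCompletion K)) φ ((absoluteGaloisGroup.toAlgEquiv (v.adicCompletion K)) (φ ^ k) t₀ - t₀ - ∑ j ∈ Finset.range k, (absoluteGaloisGroup.toAlgEquiv (v.adicCompletion K)) (φ ^ j) u) +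
            ((absoluteGaloisGroup.toAlgEquiv (v.adicCompletion K)) φ t₀ - t₀ - u) := by
        rw [Finset.sum_range_succ', pow_zero, map_one, AlgEquiv.one_apply, map_sub, map_sub, map_sum,
          pow_succ', gal_mul_apply]
        simp only [← gal_mul_apply, ← pow_succ']
        ring
      rw [e]
      refine Valuation.map_add_lt w ?_ hd
      rw [hφw]; exact ih
  have hn' : w ((absoluteGaloisGroup.toAlgEquiv (v.adicCompletion K)) (φ ^ n) t₀ - t₀) < 1 := by
    have e : (absoluteGaloisGroup.toAlgEquiv (v.adicCompletion K)) (φ ^ n) t₀ - t₀ = ((absoluteGaloisGroup.toAlgEquiv (v.adicCompletion K)) (φ ^ n) t₀ - t₀ - ∑ j ∈ Finset.range n, (absoluteGaloisGroup.toAlgEquiv (v.adicCompletion K)) (φ ^ j) u) +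
        ∑ j ∈ Finset.range n, (absoluteGaloisGroup.toAlgEquiv (v.adicCompletion K)) (φ ^ j) u := by ring
    rw [e]
    exact Valuation.map_add_lt w (hck n) htr
  -- Teichmüller representative of `t₀`
  rcases ht₀1.eq_or_lt with ht₀eq | ht₀lt
  · obtain ⟨𝔐, h𝔐⟩ := localPrimesAbove_nonempty (v := v)
    obtain ⟨ζ', hζ1, htζ, ⟨N, hN, hζN⟩, -⟩ := exists_rootOfUnity_spectralValuation_sub_lt_one hw h𝔐 ht₀eq
    have hζ0 : ζ' ≠ 0 := (Valuation.ne_zero_iff w).mp (by rw [hζ1]; exact one_ne_zero)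
    -- `φⁿ ζ' ≡ ζ'`, hence `ζ' ^ (qⁿ - 1) = 1`
    have hζn : w ((absoluteGaloisGroup.toAlgEquiv (v.adicCompletion K)) (φ ^ n) ζ' - ζ') < 1 := by
      have e : (absoluteGaloisGroup.toAlgEquiv (v.adicCompletion K)) (φ ^ n) ζ' - ζ' = (absoluteGaloisGroup.toAlgEquiv (v.adicCompletion K)) (φ ^ n) (ζ' - t₀) + ((absoluteGaloisGroup.toAlgEquiv (v.adicCompletion K)) (φ ^ n) t₀ - t₀) + (t₀ - ζ') := by
        rw [map_sub]; ring
      rw [e]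
      refine Valuation.map_add_lt w (Valuation.map_add_lt w ?_ hn') htζ
      rw [hφw, ← Valuation.map_neg, neg_sub]; exact htζ
    have hζlevel : ζ' ^ ((Nat.card (IsLocalRing.ResidueField (v.adicCompletionIntegers K))) ^ n - 1) = 1 := by
      have h1 : 1 ≤ (Nat.card (IsLocalRing.ResidueField (v.adicCompletionIntegers K))) ^ n := Nat.one_le_pow _ _ (by omega)
      apply eq_one_of_pow_eq_one_of_algNorm_sub_one_lt_one hN
      · rw [← pow_mul, mul_comm, pow_mul, hζN, one_pow]
      · rw [← spectralValuation_lt_one_iff_algNorm_lt_one hw]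
        have e : ζ' ^ ((Nat.card (IsLocalRing.ResidueField (v.adicCompletionIntegers K))) ^ n - 1) - 1 = ((absoluteGaloisGroup.toAlgEquiv (v.adicCompletion K)) (φ ^ n) ζ' - ζ') / ζ' := by
          rw [pow_apply_rootOfUnity_of_forall_sub_pow_lt_one hw hφq hN hζN n]
          field_simp
          conv_rhs => rw [← Nat.sub_add_cancel h1, pow_succ]
          ring
        rw [e, map_div₀, hζ1, div_one]
        exact hζn
    -- so `ζ'` is a power of the primitive root `ζ`, in `K_v(ζ)`
    have hmem : ζ' ∈ IntermediateField.adjoin (v.adicCompletion K) {ζ} := by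
      obtain ⟨i, -, rfl⟩ := hζ.eq_pow_of_pow_eq_one hζlevel
      exact pow_mem (IntermediateField.mem_adjoin_simple_self (v.adicCompletion K) ζ) i
    refine ⟨ζ', hmem, hζ1.le, ?_⟩
    have e : (absoluteGaloisGroup.toAlgEquiv (v.adicCompletion K)) φ ζ' - ζ' - u = (absoluteGaloisGroup.toAlgEquiv (v.adicCompletion K)) φ (ζ' - t₀) + ((absoluteGaloisGroup.toAlgEquiv (v.adicCompletion K)) φ t₀ - t₀ - u) + (t₀ - ζ') := by
      rw [map_sub]; ring
    rw [e]
    refine Valuation.map_add_lt w (Valuation.map_add_lt w ?_ hd) htζ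
    rw [hφw, ← Valuation.map_neg, neg_sub]; exact htζ
  · -- `t₀ ≡ 0`: then `u = t₀^q - t₀ ≡ 0` and `t = 0` works
    refine ⟨0, (IntermediateField.adjoin (v.adicCompletion K) {ζ}).zero_mem, by simp, ?_⟩
    rw [map_zero, sub_self, zero_sub, Valuation.map_neg, show u = t₀ ^ (Nat.card (IsLocalRing.ResidueField (v.adicCompletionIntegers K))) - t₀ by rw [ht₀q]; ring]
    refine Valuation.map_sub_lt w ?_ ht₀lt
    rw [map_pow]
    exact pow_lt_one₀ zero_le ht₀lt (by omega)

/-! ### Hensel lifts fixed by the automorphisms fixing the approximate root -/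

omit hw in
/-- **Hensel's lemma over `𝒪_w` with invariance.** For a monic `f ∈ 𝒪_w[X]` and an approximate
simple root `b₁` (`f(b₁) ∈ 𝔪_w`, `f'(b₁) ∈ 𝒪_wˣ`) there is a root `a ≡ b₁ (mod 𝔪_w)`
(`henselianLocalRing_integer`), and every `K_v`-automorphism of `K̄_v` which is a `|·|_v`-isometry,
fixes the coefficients of `f` and fixes `b₁` fixes `a` (uniqueness of the Hensel lift,
`eq_of_isRoot_of_sub_mem_maximalIdeal`). Neukirch, *ANT*, II (4.6). [cite: NeukirchANT1999, Ch. II §4 (4.6)] -/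
theorem exists_isRoot_sub_mem_forall (f : (w.integer)[X]) (hf : f.Monic) (b₁ : w.integer)
    (h₁ : f.eval b₁ ∈ IsLocalRing.maximalIdeal w.integer) (h₂ : IsUnit (f.derivative.eval b₁)) :
    ∃ a : w.integer, f.IsRoot a ∧ a - b₁ ∈ IsLocalRing.maximalIdeal w.integer ∧
      ∀ σ : (AlgebraicClosure (v.adicCompletion K)) ≃ₐ[(v.adicCompletion K)] (AlgebraicClosure (v.adicCompletion K)), (∀ z, w (σ z) = w z) →
        (∀ i, σ ((f.coeff i : w.integer) : (AlgebraicClosure (v.adicCompletion K))) = f.coeff i) → σ (b₁ : (AlgebraicClosure (v.adicCompletion K))) = b₁ →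
        σ (a : (AlgebraicClosure (v.adicCompletion K))) = a := by
  haveI := henselianLocalRing_integer w
  have hv : w.Integers w.integer := Valuation.integer.integers w
  obtain ⟨a, ha, hab⟩ := HenselianLocalRing.is_henselian f hf b₁ h₁ h₂
  refine ⟨a, ha, hab, fun σ hσ₁ hσf hσb ↦ ?_⟩
  have hσa1 : w (σ (a : (AlgebraicClosure (v.adicCompletion K)))) ≤ 1 := (hσ₁ _).le.trans a.2
  set a' : w.integer := ⟨σ (a : (AlgebraicClosure (v.adicCompletion K))), hσa1⟩ with ha'
  have hroot : f.IsRoot a' := by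
    rw [IsRoot.def]
    apply hv.hom_inj
    rw [map_zero, ← eval_map_algebraMap_integer]
    change (f.map (algebraMap w.integer (AlgebraicClosure (v.adicCompletion K)))).eval (σ (a : (AlgebraicClosure (v.adicCompletion K)))) = 0
    rw [← algEquiv_eval_of_forall_coeff (σ := σ) (fun i ↦ by rw [coeff_map]; exact hσf i),
      eval_map_algebraMap_integer, show f.eval a = 0 from ha, map_zero, map_zero]
  have hcong : a' - b₁ ∈ IsLocalRing.maximalIdeal w.integer := by
    rw [← IsLocalRing.residue_eq_zero_iff, ← v_algebraMap_lt_one_iff hv]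
    change w ((σ (a : (AlgebraicClosure (v.adicCompletion K)))) - b₁) < 1
    have hab' : w ((a : (AlgebraicClosure (v.adicCompletion K))) - b₁) < 1 := by
      have := hab
      rw [← IsLocalRing.residue_eq_zero_iff, ← v_algebraMap_lt_one_iff hv] at this
      exact this
    rw [← hσb, ← map_sub, hσ₁]
    exact hab'
  have := eq_of_isRoot_of_sub_mem_maximalIdeal f hroot ha hcong hab h₂
  exact congrArg (fun z : w.integer ↦ (z : (AlgebraicClosure (v.adicCompletion K)))) this

end IsDedekindDomain.HeightOneSpectrum

/-! ## Chart congruences in `E₁` (complements to `FormalGroupChart`) -/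

namespace Literature.NumberTheory.EllipticCurves.FormalGroupChart

section General

variable {F : Type*} [Field F] {w : Valuation F ℝ≥0} {V : WeierstrassCurve F} [hV : V.IsIntegral w.integer]

/-- `z(-P) ≡ -z(P) (mod |z(P)|²)` on `E₁` (from `val_zCoord_add_sub_le` for `P + (-P) = O`).
Silverman, *AEC*, IV.1–2. [cite: SilvermanAEC2009, Ch. IV Prop. 2.3] -/
theorem val_zCoord_add_neg_le {P : V.toAffine.Point} (hP : P ∈ kernel w V) :
    w (P.zCoord + (-P).zCoord) ≤ w P.zCoord ^ 2 := by
  have h := val_zCoord_add_sub_le hP ((kernel w V).neg_mem hP)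
  rw [add_neg_cancel, WeierstrassCurve.Affine.Point.zCoord_zero, val_zCoord_neg hP, max_self, zero_sub,
    ← neg_add', Valuation.map_neg] at h
  exact h

/-- `z(P - Q) ≡ z(P) - z(Q) (mod max(|z(P)|,|z(Q)|)²)` on `E₁`. Silverman, *AEC*, IV.1–2.
[cite: SilvermanAEC2009, Ch. IV Prop. 2.3] -/
theorem val_zCoord_sub_sub_le {P Q : V.toAffine.Point} (hP : P ∈ kernel w V) (hQ : Q ∈ kernel w V) :
    w ((P - Q).zCoord - (P.zCoord - Q.zCoord)) ≤ max (w P.zCoord) (w Q.zCoord) ^ 2 := by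
  have h1 := val_zCoord_add_sub_le hP ((kernel w V).neg_mem hQ)
  rw [val_zCoord_neg hQ, ← sub_eq_add_neg] at h1
  have h2 := val_zCoord_add_neg_le hQ
  have e : (P - Q).zCoord - (P.zCoord - Q.zCoord) =
      ((P - Q).zCoord - P.zCoord - (-Q).zCoord) + (Q.zCoord + (-Q).zCoord) := by ring
  rw [e]
  refine (Valuation.map_add w _ _).trans (max_le h1 (h2.trans ?_))
  exact pow_le_pow_left₀ zero_le (le_max_right _ _) 2

end General

end Literature.NumberTheory.EllipticCurves.FormalGroupChart

/-! ## Points of `E₁` with prescribed parameter `z ∈ 𝔪`, and open stabilisers -/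

namespace IsDedekindDomain.HeightOneSpectrum

open Literature.NumberTheory.EllipticCurves Literature.NumberTheory.EllipticCurves.FormalGroupChart
  Literature.NumberTheory.GaloisRepresentations WeierstrassCurve

variable {K : Type u} [Field K] [NumberField K] {v : HeightOneSpectrum (𝓞 K)}
  {w : Valuation (AlgebraicClosure (v.adicCompletion K)) ℝ≥0}


/-- **`z` maps `E₁(K̄_v)` onto `𝔐`, equivariantly.** For a Weierstrass equation `X/K_v` whose base
change `V = X ⊗ K̄_v` is `w`-integral and smooth, every `a ∈ K̄_v` with `|a|_v < 1` is `z(P)` for a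
point `P ∈ V₁(K̄_v)` which is moreover fixed by every isometric `K_v`-automorphism fixing `a`:
`P = (x, y)` with `x = -a y` and `Y = a³ y` the Hensel root `≡ -(1 - a₁a - a₂a²)` of the monic
cubic `Y³ + (1 - a₁a - a₂a²) Y² + (a₃ + a₄a) a³ Y - a₆ a⁶` (`FormalGroupChart.monic_cubic_eval`,
`approxRoot`, `one_lt_val_of_root`; uniqueness of Hensel lifts gives the invariance). This is the
surjectivity half of `z : E₁ ≃ 𝔐` (Silverman, *AEC*, VII.2.2 / IV.3.2(a)).
[cite: SilvermanAEC2009, Prop. VII.2.2] -/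
theorem exists_mem_kernel_zCoord_eq (Xv : WeierstrassCurve (v.adicCompletion K))
    [hV : (Xv.baseChange (AlgebraicClosure (v.adicCompletion K))).IsIntegral w.integer] [(Xv.baseChange (AlgebraicClosure (v.adicCompletion K))).IsElliptic]
    {a : (AlgebraicClosure (v.adicCompletion K))} (ha : w a < 1) :
    ∃ P ∈ kernel w (Xv.baseChange (AlgebraicClosure (v.adicCompletion K))), P.zCoord = a ∧
      ∀ σ : (AlgebraicClosure (v.adicCompletion K)) ≃ₐ[(v.adicCompletion K)] (AlgebraicClosure (v.adicCompletion K)), (∀ z, w (σ z) = w z) → σ a = a →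
        Affine.Point.map (σ : (AlgebraicClosure (v.adicCompletion K)) →ₐ[(v.adicCompletion K)] (AlgebraicClosure (v.adicCompletion K))) P = P := by
  by_cases ha0 : a = 0
  · refine ⟨0, (kernel w _).zero_mem, by rw [WeierstrassCurve.Affine.Point.zCoord_zero, ha0], fun σ _ _ ↦ by rw [map_zero]⟩
  have ha0' : 0 < w a := (Valuation.pos_iff w).mpr ha0
  have hvw : w.Integers w.integer := Valuation.integer.integers w
  have ha1 : w a ≤ 1 := ha.le
  have ha₃ : w (Xv.baseChange (AlgebraicClosure (v.adicCompletion K))).a₃ ≤ 1 := val_a₃_le_one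
  have ha₄ : w (Xv.baseChange (AlgebraicClosure (v.adicCompletion K))).a₄ ≤ 1 := val_a₄_le_one
  have ha₆ : w (Xv.baseChange (AlgebraicClosure (v.adicCompletion K))).a₆ ≤ 1 := val_a₆_le_one
  -- the coefficients of the monic cubic
  set u : (AlgebraicClosure (v.adicCompletion K)) := 1 - (Xv.baseChange (AlgebraicClosure (v.adicCompletion K))).a₁ * a - (Xv.baseChange (AlgebraicClosure (v.adicCompletion K))).a₂ * a ^ 2 with hu
  set c : (AlgebraicClosure (v.adicCompletion K)) := ((Xv.baseChange (AlgebraicClosure (v.adicCompletion K))).a₃ + (Xv.baseChange (AlgebraicClosure (v.adicCompletion K))).a₄ * a) * a ^ 3 with hc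
  set d : (AlgebraicClosure (v.adicCompletion K)) := (Xv.baseChange (AlgebraicClosure (v.adicCompletion K))).a₆ * a ^ 6 with hd
  obtain ⟨hu1, happ, huniq⟩ := approxRoot (V := Xv.baseChange (AlgebraicClosure (v.adicCompletion K))) (w := w) ha
  have hu_le : w u ≤ 1 := hu1.le
  have hca : w c ≤ w a ^ 3 := by
    rw [hc, map_mul, map_pow]
    refine mul_le_of_le_one_left zero_le ?_
    refine (Valuation.map_add w _ _).trans (max_le ha₃ ?_)
    rw [map_mul]; exact mul_le_one' ha₄ ha1
  have ha3lt : w a ^ 3 < 1 := pow_lt_one₀ zero_le ha three_ne_zero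
  have hc1 : w c ≤ 1 := hca.trans ha3lt.le
  have hd1 : w d ≤ 1 := by
    rw [hd, map_mul, map_pow]; exact mul_le_one' ha₆ (pow_le_one₀ zero_le ha1)
  -- Galois invariance of the coefficients
  have hσcoef : ∀ σ : (AlgebraicClosure (v.adicCompletion K)) ≃ₐ[(v.adicCompletion K)] (AlgebraicClosure (v.adicCompletion K)), σ a = a → σ u = u ∧ σ c = c ∧ σ d = d := by
    intro σ hσa
    have e₁ : σ (Xv.baseChange (AlgebraicClosure (v.adicCompletion K))).a₁ = (Xv.baseChange (AlgebraicClosure (v.adicCompletion K))).a₁ := σ.commutes Xv.a₁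
    have e₂ : σ (Xv.baseChange (AlgebraicClosure (v.adicCompletion K))).a₂ = (Xv.baseChange (AlgebraicClosure (v.adicCompletion K))).a₂ := σ.commutes Xv.a₂
    have e₃ : σ (Xv.baseChange (AlgebraicClosure (v.adicCompletion K))).a₃ = (Xv.baseChange (AlgebraicClosure (v.adicCompletion K))).a₃ := σ.commutes Xv.a₃
    have e₄ : σ (Xv.baseChange (AlgebraicClosure (v.adicCompletion K))).a₄ = (Xv.baseChange (AlgebraicClosure (v.adicCompletion K))).a₄ := σ.commutes Xv.a₄
    have e₆ : σ (Xv.baseChange (AlgebraicClosure (v.adicCompletion K))).a₆ = (Xv.baseChange (AlgebraicClosure (v.adicCompletion K))).a₆ := σ.commutes Xv.a₆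
    refine ⟨?_, ?_, ?_⟩
    · rw [hu]; simp only [map_sub, map_one, map_mul, map_pow, hσa, e₁, e₂]
    · rw [hc]; simp only [map_add, map_mul, map_pow, hσa, e₃, e₄]
    · rw [hd]; simp only [map_mul, map_pow, hσa, e₆]
  -- the monic cubic over `𝒪_w` and its approximate root `-u`
  set f : (w.integer)[X] := X ^ 3 + C ⟨u, hu_le⟩ * X ^ 2 + C ⟨c, hc1⟩ * X - C ⟨d, hd1⟩ with hf
  have hfmonic : f.Monic := by
    rw [hf, sub_eq_add_neg, add_assoc, add_assoc]
    refine (monic_X_pow 3).add_of_left ?_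
    refine (degree_add_le _ _).trans_lt (max_lt ?_ ((degree_add_le _ _).trans_lt (max_lt ?_ ?_)))
    · exact (degree_C_mul_X_pow_le 2 _).trans_lt (by rw [degree_X_pow]; norm_num)
    · exact (degree_C_mul_X_le _).trans_lt (by rw [degree_X_pow]; norm_num)
    · rw [degree_neg]; exact (degree_C_le).trans_lt (by rw [degree_X_pow]; norm_num)
  have hfeval : ∀ Y : w.integer, ((f.eval Y : w.integer) : (AlgebraicClosure (v.adicCompletion K))) = (Y : (AlgebraicClosure (v.adicCompletion K))) ^ 3 + u * Y ^ 2 + c * Y - d := by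
    intro Y
    rw [hf]
    simp only [eval_add, eval_sub, eval_mul, eval_pow, eval_X, eval_C]
    push_cast
    rfl
  have hfmap : f.map (algebraMap w.integer (AlgebraicClosure (v.adicCompletion K))) = X ^ 3 + C u * X ^ 2 + C c * X - C d := by
    rw [hf]
    simp only [Polynomial.map_add, Polynomial.map_sub, Polynomial.map_mul, Polynomial.map_pow, map_X, map_C]
    rfl
  have hfder : ∀ Y : w.integer, ((f.derivative.eval Y : w.integer) : (AlgebraicClosure (v.adicCompletion K))) =
      3 * (Y : (AlgebraicClosure (v.adicCompletion K))) ^ 2 + 2 * u * Y + c := by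
    intro Y
    change algebraMap w.integer (AlgebraicClosure (v.adicCompletion K)) (f.derivative.eval Y) = _
    rw [← eval_map_algebraMap_integer, ← derivative_map, hfmap]
    simp only [derivative_add, derivative_sub, derivative_X_pow, derivative_mul, derivative_C,
      derivative_X, zero_mul, zero_add, mul_one, sub_zero, eval_add, eval_mul, eval_pow, eval_X,
      eval_C, Nat.cast_ofNat, pow_one, Nat.add_one_sub_one]
    ring
  have hfcoeff : ∀ σ : (AlgebraicClosure (v.adicCompletion K)) ≃ₐ[(v.adicCompletion K)] (AlgebraicClosure (v.adicCompletion K)), σ a = a → ∀ i, σ ((f.coeff i : w.integer) : (AlgebraicClosure (v.adicCompletion K))) = f.coeff i := by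
    intro σ hσa i
    obtain ⟨eu, ec, ed⟩ := hσcoef σ hσa
    rw [hf]
    simp only [coeff_add, coeff_sub, coeff_X_pow, coeff_C_mul, coeff_X, coeff_C]
    push_cast
    split_ifs <;> simp [eu, ec, ed]
  set b₁ : w.integer := ⟨-u, by change w (-u) ≤ 1; rw [Valuation.map_neg]; exact hu_le⟩ with hb₁
  have hb₁c : ((b₁ : w.integer) : (AlgebraicClosure (v.adicCompletion K))) = -u := rfl
  have h₁ : f.eval b₁ ∈ IsLocalRing.maximalIdeal w.integer := by
    rw [← IsLocalRing.residue_eq_zero_iff, ← v_algebraMap_lt_one_iff hvw]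
    change w ((f.eval b₁ : w.integer) : (AlgebraicClosure (v.adicCompletion K))) < 1
    rw [hfeval, hb₁c]
    refine lt_of_le_of_lt (le_trans (le_of_eq ?_) happ) ha3lt
    rw [hu, hc, hd]
  have h₂ : IsUnit (f.derivative.eval b₁) := by
    rw [hvw.isUnit_iff_valuation_eq_one]
    change w ((f.derivative.eval b₁ : w.integer) : (AlgebraicClosure (v.adicCompletion K))) = 1
    rw [hfder, hb₁c, show (3 : (AlgebraicClosure (v.adicCompletion K))) * (-u) ^ 2 + 2 * u * -u + c = u ^ 2 + c by ring]
    rw [Valuation.map_add_eq_of_lt_left]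
    · rw [map_pow, hu1, one_pow]
    · rw [map_pow, hu1, one_pow]; exact hca.trans_lt ha3lt
  obtain ⟨Y₀, hY₀root, hY₀cong, hY₀fix⟩ := exists_isRoot_sub_mem_forall (v := v) f hfmonic b₁ h₁ h₂
  -- `|Y₀| = 1`
  have hY₀1 : w (Y₀ : (AlgebraicClosure (v.adicCompletion K))) = 1 := by
    refine huniq _ ?_
    have := hY₀cong
    rw [← IsLocalRing.residue_eq_zero_iff, ← v_algebraMap_lt_one_iff hvw] at this
    change w ((Y₀ : (AlgebraicClosure (v.adicCompletion K))) - (b₁ : (AlgebraicClosure (v.adicCompletion K)))) < 1 at this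
    rwa [hb₁c, sub_neg_eq_add] at this
  -- the point
  have ha3 : a ^ 3 ≠ 0 := pow_ne_zero 3 ha0
  set y : (AlgebraicClosure (v.adicCompletion K)) := (Y₀ : (AlgebraicClosure (v.adicCompletion K))) / a ^ 3 with hy
  have hYy : (Y₀ : (AlgebraicClosure (v.adicCompletion K))) = y * a ^ 3 := by rw [hy, div_mul_cancel₀ _ ha3]
  have hrootL : (Y₀ : (AlgebraicClosure (v.adicCompletion K))) ^ 3 + u * Y₀ ^ 2 + c * Y₀ - d = 0 := by
    have h := congrArg (fun z : w.integer ↦ (z : (AlgebraicClosure (v.adicCompletion K)))) (show f.eval Y₀ = 0 from hY₀root)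
    simp only [hfeval] at h
    simpa using h
  have hg : a ^ 3 * y ^ 3 + (1 - (Xv.baseChange (AlgebraicClosure (v.adicCompletion K))).a₁ * a - (Xv.baseChange (AlgebraicClosure (v.adicCompletion K))).a₂ * a ^ 2) * y ^ 2 +
      ((Xv.baseChange (AlgebraicClosure (v.adicCompletion K))).a₃ + (Xv.baseChange (AlgebraicClosure (v.adicCompletion K))).a₄ * a) * y - (Xv.baseChange (AlgebraicClosure (v.adicCompletion K))).a₆ = 0 := by
    have hm := monic_cubic_eval (V := Xv.baseChange (AlgebraicClosure (v.adicCompletion K))) a y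
    rw [← hYy] at hm
    have h6 : a ^ 6 * (a ^ 3 * y ^ 3 + (1 - (Xv.baseChange (AlgebraicClosure (v.adicCompletion K))).a₁ * a - (Xv.baseChange (AlgebraicClosure (v.adicCompletion K))).a₂ * a ^ 2) * y ^ 2 +
        ((Xv.baseChange (AlgebraicClosure (v.adicCompletion K))).a₃ + (Xv.baseChange (AlgebraicClosure (v.adicCompletion K))).a₄ * a) * y - (Xv.baseChange (AlgebraicClosure (v.adicCompletion K))).a₆) = 0 := by
      rw [← hm, ← hrootL, hu, hc, hd]
    exact (mul_eq_zero.mp h6).resolve_left (pow_ne_zero 6 ha0)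
  have heq : (Xv.baseChange (AlgebraicClosure (v.adicCompletion K))).toAffine.Equation (-a * y) y := equation_of_root hg
  have hns : (Xv.baseChange (AlgebraicClosure (v.adicCompletion K))).toAffine.Nonsingular (-a * y) y :=
    (Affine.equation_iff_nonsingular).mp heq
  have hwy : w y * w a ^ 3 = 1 := by rw [← map_pow, ← map_mul, ← hYy, hY₀1]
  have hy0 : y ≠ 0 := by
    intro h; rw [h, map_zero, zero_mul] at hwy; exact zero_ne_one hwy
  refine ⟨.some _ _ hns, some_mem_kernel hns (one_lt_val_of_root ha0' ha hwy), ?_, fun σ hσ hσa ↦ ?_⟩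
  · rw [WeierstrassCurve.Affine.Point.zCoord_some]
    field_simp
  · have hσY : σ (Y₀ : (AlgebraicClosure (v.adicCompletion K))) = Y₀ :=
      hY₀fix σ hσ (hfcoeff σ hσa) (by rw [hb₁c, map_neg, (hσcoef σ hσa).1])
    have hσy : σ y = y := by rw [hy, map_div₀, map_pow, hσY, hσa]
    rw [Affine.Point.map_some]
    exact point_some_eq_some (by change σ (-a * y) = -a * y; rw [map_mul, map_neg, hσa, hσy])
      (by change σ y = y; exact hσy)

/-- **Stabilisers of points are open** in `Γ_{K_v}` (the Krull topology): the stabiliser of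
`P = (x, y)` contains the open subgroup `Gal(K̄_v/K_v(x, y))` (`IntermediateField.fixingSubgroup_isOpen`),
i.e. `E(K̄_v)` is a discrete `Γ_{K_v}`-module. Serre, *Galois Cohomology*, II §1; Silverman, *AEC*,
VIII §1. [cite: SerreGaloisCohomology1997, Ch. II §1] -/
theorem isOpen_setOf_map_eq (Xv : WeierstrassCurve (v.adicCompletion K)) (P : (Xv.baseChange (AlgebraicClosure (v.adicCompletion K))).toAffine.Point) :
    IsOpen {σ : absoluteGaloisGroup (v.adicCompletion K) |
      Affine.Point.map (((absoluteGaloisGroup.toAlgEquiv (v.adicCompletion K)) σ : (AlgebraicClosure (v.adicCompletion K)) ≃ₐ[(v.adicCompletion K)] (AlgebraicClosure (v.adicCompletion K))) : (AlgebraicClosure (v.adicCompletion K)) →ₐ[(v.adicCompletion K)] (AlgebraicClosure (v.adicCompletion K))) P = P} := by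
  rcases P with _ | ⟨x, y, h⟩
  · have : {σ : absoluteGaloisGroup (v.adicCompletion K) | Affine.Point.map (((absoluteGaloisGroup.toAlgEquiv (v.adicCompletion K)) σ : (AlgebraicClosure (v.adicCompletion K)) ≃ₐ[(v.adicCompletion K)] (AlgebraicClosure (v.adicCompletion K))) : (AlgebraicClosure (v.adicCompletion K)) →ₐ[(v.adicCompletion K)] (AlgebraicClosure (v.adicCompletion K)))
        (0 : (Xv.baseChange (AlgebraicClosure (v.adicCompletion K))).toAffine.Point) = 0} = Set.univ :=
      Set.eq_univ_of_forall fun σ ↦ by simp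
    rw [← Affine.Point.zero_def, this]; exact isOpen_univ
  · -- the open subgroup `Gal(K̄_v / K_v(x, y))` stabilises `P`
    set L₀ : IntermediateField (v.adicCompletion K) (AlgebraicClosure (v.adicCompletion K)) := IntermediateField.adjoin (v.adicCompletion K) {x, y} with hL₀
    haveI : FiniteDimensional (v.adicCompletion K) L₀ := by
      rw [hL₀]
      exact IntermediateField.finiteDimensional_adjoin fun z _ ↦ Algebra.IsIntegral.isIntegral z
    have hopen : IsOpen (L₀.fixingSubgroup : Set ((AlgebraicClosure (v.adicCompletion K)) ≃ₐ[(v.adicCompletion K)] (AlgebraicClosure (v.adicCompletion K)))) := L₀.fixingSubgroup_isOpen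
    have hsub : ∀ τ ∈ L₀.fixingSubgroup, τ x = x ∧ τ y = y := by
      intro τ hτ
      rw [IntermediateField.mem_fixingSubgroup_iff] at hτ
      exact ⟨hτ x (IntermediateField.subset_adjoin _ _ (by simp)),
        hτ y (IntermediateField.subset_adjoin _ _ (by simp))⟩
    rw [isOpen_iff_forall_mem_open]
    intro σ₀ hσ₀
    refine ⟨(fun τ ↦ σ₀ * τ) '' (L₀.fixingSubgroup : Set ((AlgebraicClosure (v.adicCompletion K)) ≃ₐ[(v.adicCompletion K)] (AlgebraicClosure (v.adicCompletion K)))), ?_, ?_, ⟨1, L₀.fixingSubgroup.one_mem, mul_one σ₀⟩⟩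
    · rintro _ ⟨τ, hτ, rfl⟩
      simp only [Set.mem_setOf_eq] at hσ₀ ⊢
      obtain ⟨hx, hy⟩ := hsub τ hτ
      rw [map_mul]
      change Affine.Point.map ((((absoluteGaloisGroup.toAlgEquiv (v.adicCompletion K)) σ₀ : (AlgebraicClosure (v.adicCompletion K)) ≃ₐ[(v.adicCompletion K)] (AlgebraicClosure (v.adicCompletion K))) * ((absoluteGaloisGroup.toAlgEquiv (v.adicCompletion K)) τ : (AlgebraicClosure (v.adicCompletion K)) ≃ₐ[(v.adicCompletion K)] (AlgebraicClosure (v.adicCompletion K))) : (AlgebraicClosure (v.adicCompletion K)) ≃ₐ[(v.adicCompletion K)] (AlgebraicClosure (v.adicCompletion K))) :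
        (AlgebraicClosure (v.adicCompletion K)) →ₐ[(v.adicCompletion K)] (AlgebraicClosure (v.adicCompletion K))) (.some x y h) = .some x y h
      have e : ((((absoluteGaloisGroup.toAlgEquiv (v.adicCompletion K)) σ₀ : (AlgebraicClosure (v.adicCompletion K)) ≃ₐ[(v.adicCompletion K)] (AlgebraicClosure (v.adicCompletion K))) * ((absoluteGaloisGroup.toAlgEquiv (v.adicCompletion K)) τ : (AlgebraicClosure (v.adicCompletion K)) ≃ₐ[(v.adicCompletion K)] (AlgebraicClosure (v.adicCompletion K))) : (AlgebraicClosure (v.adicCompletion K)) ≃ₐ[(v.adicCompletion K)] (AlgebraicClosure (v.adicCompletion K))) : (AlgebraicClosure (v.adicCompletion K)) →ₐ[(v.adicCompletion K)] (AlgebraicClosure (v.adicCompletion K))) =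
          (((absoluteGaloisGroup.toAlgEquiv (v.adicCompletion K)) σ₀ : (AlgebraicClosure (v.adicCompletion K)) ≃ₐ[(v.adicCompletion K)] (AlgebraicClosure (v.adicCompletion K))) : (AlgebraicClosure (v.adicCompletion K)) →ₐ[(v.adicCompletion K)] (AlgebraicClosure (v.adicCompletion K))).comp (((absoluteGaloisGroup.toAlgEquiv (v.adicCompletion K)) τ : (AlgebraicClosure (v.adicCompletion K)) ≃ₐ[(v.adicCompletion K)] (AlgebraicClosure (v.adicCompletion K))) : (AlgebraicClosure (v.adicCompletion K)) →ₐ[(v.adicCompletion K)] (AlgebraicClosure (v.adicCompletion K))) := rfl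
      have hτP : Affine.Point.map (((absoluteGaloisGroup.toAlgEquiv (v.adicCompletion K)) τ : (AlgebraicClosure (v.adicCompletion K)) ≃ₐ[(v.adicCompletion K)] (AlgebraicClosure (v.adicCompletion K))) : (AlgebraicClosure (v.adicCompletion K)) →ₐ[(v.adicCompletion K)] (AlgebraicClosure (v.adicCompletion K))) (.some x y h) = .some x y h := by
        rw [Affine.Point.map_some]; exact point_some_eq_some hx hy
      rw [e, ← Affine.Point.map_map, hτP]
      exact hσ₀
    · exact (Homeomorph.mulLeft σ₀).isOpenMap _ hopen

/-- Points fixed by `Gal(K̄_v/L)` have coordinates in `L` (`K̄_v/K_v` is Galois: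
`InfiniteGalois.fixedField_fixingSubgroup`). [folklore] -/
theorem mem_of_forall_mem_fixingSubgroup (L : IntermediateField (v.adicCompletion K) (AlgebraicClosure (v.adicCompletion K))) {x : (AlgebraicClosure (v.adicCompletion K))}
    (hx : ∀ σ ∈ L.fixingSubgroup, σ x = x) : x ∈ L := by
  haveI := isGalois_algebraicClosure_adicCompletion (v := v)
  rw [← InfiniteGalois.fixedField_fixingSubgroup L]
  exact (IntermediateField.mem_fixedField_iff _ _).mpr hx

end IsDedekindDomain.HeightOneSpectrum
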